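import Literature.AlgebraicGeometry.Morphisms.GenericFibreSmooth
import Mathlib.RingTheory.Smooth.Fiber
import Mathlib.RingTheory.RingHom.Flat
import Mathlib.AlgebraicGeometry.Morphisms.SmoothFiber
import Mathlib.AlgebraicGeometry.Morphisms.UniversallyClosed
import HarnessLib

/-!
# Flat at a point with smooth fibre ⇒ smooth at the point; smoothness over an open from a fibre

Topic: `Literature/AlgebraicGeometry/Morphisms`. The pointwise form of "flat + smooth fibres ⇒
smooth" (EGA IV₄ 17.5.1, Stacks 01V8/00TF) and the elementary spreading-out used in de Jong 1996,
4.12 ("`f`, having one nonsingular fibre and `ℙ^{d-1}` being nonsingular imply that `f` is smooth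
over a nonempty open part of `ℙ^{d-1}`"):

* `Algebra.IsSmoothAt.of_flat_localRingHom_of_formallySmooth_fiber` — Mathlib's
  `Algebra.IsSmoothAt.of_formallySmooth_fiber` (Stacks 00TF) with its global hypothesis
  `Module.Flat R S` weakened to flatness of the single local homomorphism `R_p → S_q`: if `S` is a
  finitely presented `R`-algebra, `q ⊂ S` lies over `p ⊂ R`, `R_p → S_q` is flat and the fibre
  `κ(p) ⊗_R S` is formally smooth over `κ(p)`, then `S` is smooth at `q` (same proof:
  `Algebra.FormallySmooth.of_formallySmooth_residueField_tensor` for `S_q` over `R_p`).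
* `mem_smoothLocus_of_flat_stalkMap_of_smooth_fiber` — for `f : X → Y` locally of finite
  presentation and `x ∈ X`: if `𝒪_{Y,f x} → 𝒪_{X,x}` is flat and the fibre `X_{f x} → Spec κ(f x)`
  is smooth, then `x ∈ sm(X/Y)` (affine charts, `IsAffineOpen.arrowStalkMapIso`, and the fibre of
  `Spec Γ(X, V) → Spec Γ(Y, U)` over the prime of `f x` is an open subscheme of a base change of
  `X_{f x}`).
* `exists_smooth_morphismRestrict_of_forall_mem_smoothLocus` — if `f` is moreover a closed map
  (universally closed) and the whole fibre over `y` lies in `sm(X/Y)`, then `f⁻¹(V) → V` is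
  smooth for the open `V = Y ∖ f(X ∖ sm(X/Y)) ∋ y`.

## References

* A. Grothendieck, EGA IV₄ (1967), Thm. 17.5.1; The Stacks Project, Tags 00TF, 01V8.
  [StacksProject]
* A. J. de Jong, *Smoothness, semi-stability and alterations*, Publ. Math. IHÉS 83 (1996), 2.8
  and 4.12 (p. 68). [DeJong1996]
-/

noncomputable section

universe u

open scoped TensorProduct
open CategoryTheory CategoryTheory.Limits AlgebraicGeometry TopologicalSpace

/-! ### The local algebra statement (Stacks 00TF, pointwise flatness) -/

namespace Algebra

open IsLocalRing

/-- **Flat at `q` with formally smooth fibre ⇒ smooth at `q`** (a deliberate dot-notation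
extension of Mathlib's `Algebra.IsSmoothAt`; it is Mathlib's
`Algebra.IsSmoothAt.of_formallySmooth_fiber`, Stacks 00TF, with `Module.Flat R S` replaced by
the flatness of `R_p → S_q` alone). Let `S` be a finitely presented `R`-algebra, `q ⊂ S` a prime
lying over `p ⊂ R`, such that the local homomorphism `R_p → S_q` is flat and `κ(p) ⊗_R S` is
formally smooth over `κ(p)`. Then `S` is smooth at `q`: `S_q` is a localization of the finitely
presented `R_p`-algebra `S_p`, and `κ(R_p) ⊗ S_q` is formally smooth over `κ(R_p) = κ(p)`, so
`Algebra.FormallySmooth.of_formallySmooth_residueField_tensor` applies.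
[cite: StacksProject, Tag 00TF] -/
theorem IsSmoothAt.of_flat_localRingHom_of_formallySmooth_fiber {R S : Type*} [CommRing R]
    [CommRing S] [Algebra R S] [Algebra.FinitePresentation R S] (p : Ideal R) (q : Ideal S)
    [p.IsPrime] [q.IsPrime] [q.LiesOver p]
    (hflat : (Localization.localRingHom p q (algebraMap R S) Ideal.LiesOver.over).Flat)
    [FormallySmooth p.ResidueField (p.Fiber S)] : Algebra.IsSmoothAt R q := by
  let Rp := Localization.AtPrime p
  let Sp := Localization (algebraMapSubmonoid S p.primeCompl)
  let Sq := Localization.AtPrime q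
  let := Localization.AtPrime.algebraOfLiesOver p q
  haveI : Module.Flat Rp Sq := hflat
  let f : Sp →ₐ[S] Sq := IsLocalization.liftAlgHom (M := algebraMapSubmonoid S p.primeCompl)
        (f := Algebra.ofId _ _) (by
      rintro ⟨_, x, hx, rfl⟩
      simpa using! IsLocalization.map_units (M := q.primeCompl) Sq ⟨algebraMap _ _ x,
        by simp_all [q.over_def p]⟩)
  algebraize [f.toRingHom]
  have : IsScalarTower R Sp Sq := .to₁₃₄ _ S _ _
  have : IsScalarTower Rp Sp Sq := .of_algebraMap_eq' <| by
    apply IsLocalization.ringHom_ext p.primeCompl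
    simp only [RingHom.comp_assoc, ← IsScalarTower.algebraMap_eq]
  have : IsLocalization (algebraMapSubmonoid Sp q.primeCompl) Sq :=
    .isLocalization_of_submonoid_le _ _ (algebraMapSubmonoid S p.primeCompl) _
    (by rintro _ ⟨x, hx, rfl⟩; simp_all [q.over_def p])
  have : FinitePresentation Rp Sp := by
    have : Algebra.IsPushout R Rp S Sp :=
      .symm <| Algebra.isPushout_of_isLocalization p.primeCompl _ _ _
    exact .equiv (Algebra.IsPushout.equiv R Rp S Sp)
  have : FormallySmooth (ResidueField Rp) (ResidueField Rp ⊗[Rp] Sq) := by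
    let : Algebra S (ResidueField Rp ⊗[R] S) := TensorProduct.rightAlgebra
    have : FormallySmooth (ResidueField Rp) ((ResidueField Rp ⊗[R] S) ⊗[S] Sq) :=
      .comp _ (ResidueField Rp ⊗[R] S) _
    let e : ResidueField Rp ⊗[R] S ≃ₐ[S] S ⊗[R] ResidueField Rp :=
      { __ := TensorProduct.comm _ _ _, commutes' _ := rfl }
    let e' : (ResidueField Rp ⊗[R] S) ⊗[S] Sq ≃ₐ[R] ResidueField Rp ⊗[Rp] Sq :=
      ((TensorProduct.comm _ _ _).restrictScalars R).trans <|
      ((TensorProduct.congr (.refl (R := S)) e).restrictScalars R).trans <|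
      ((TensorProduct.cancelBaseChange _ _ S _ _).restrictScalars R).trans <|
      (TensorProduct.comm _ _ _).trans (TensorProduct.equivOfCompatibleSMul ..)
    have : e'.toAlgHom.comp (IsScalarTower.toAlgHom R p.ResidueField _) =
        IsScalarTower.toAlgHom _ _ _ := by ext
    let e'' : (ResidueField Rp ⊗[R] S) ⊗[S] Sq ≃ₐ[ResidueField Rp] ResidueField Rp ⊗[Rp] Sq :=
      { __ := e', commutes' r := congr($this r) }
    exact .of_equiv e''
  have := FormallySmooth.of_formallySmooth_residueField_tensor
    (R := Rp) (S := Sq) (P := Sp) (algebraMapSubmonoid _ q.primeCompl)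
  exact .comp R Rp Sq

end Algebra

/-! ### The pointwise scheme statement -/

namespace Literature.AlgebraicGeometry.Morphisms

variable {X Y : Scheme.{u}}

/-- **Flat at `x` with smooth fibre through `x` ⇒ smooth at `x`.** Let `f : X → Y` be locally of
finite presentation and `x ∈ X`. If the stalk map `𝒪_{Y,f x} → 𝒪_{X,x}` is flat and the fibre
`X_{f x} → Spec κ(f x)` is smooth, then `x` lies in the smooth locus of `f` (Mathlib's
`Scheme.Hom.smoothLocus`: the stalk map is formally smooth). Proof: on affine charts
`x ∈ V ⊆ f⁻¹(U)` the stalk map is `Γ(Y,U)_𝔭 → Γ(X,V)_𝔮` (`IsAffineOpen.arrowStalkMapIso`), and the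
fibre of `Spec Γ(X,V) → Spec Γ(Y,U)` over `𝔭` is an open subscheme of the base change of
`X_{f x}` along `Spec κ(𝔭) ≅ Spec κ(f x)`, hence smooth; conclude by
`Algebra.IsSmoothAt.of_flat_localRingHom_of_formallySmooth_fiber`.
[cite: StacksProject, Tag 01V8] -/
theorem mem_smoothLocus_of_flat_stalkMap_of_smooth_fiber (f : X ⟶ Y)
    [LocallyOfFinitePresentation f] {x : X} (hflat : (f.stalkMap x).hom.Flat)
    (hsm : Smooth (f.fiberToSpecResidueField (f x))) : x ∈ f.smoothLocus := by
  obtain ⟨_, ⟨U, hU, rfl⟩, hxU, -⟩ :=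
    Y.isBasis_affineOpens.exists_subset_of_mem_open (Set.mem_univ (f x)) isOpen_univ
  obtain ⟨_, ⟨V, hV, rfl⟩, hxV, hVU⟩ :=
    X.isBasis_affineOpens.exists_subset_of_mem_open hxU (U.2.preimage f.continuous)
  have := f.finitePresentation_appLE hU hV hVU
  algebraize [(f.appLE U V hVU).hom]
  rw [Scheme.Hom.mem_smoothLocus, formallySmooth_stalkMap_iff U hU V hV hVU hxV]
  let p := hU.primeIdealOf ⟨f x, hVU hxV⟩
  let q := hV.primeIdealOf ⟨x, hxV⟩
  haveI hqp : q.asIdeal.LiesOver p.asIdeal :=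
    ⟨congr($(IsAffineOpen.comap_primeIdealOf_appLE U hU V hV hVU hxV).1).symm⟩
  change Algebra.IsSmoothAt Γ(Y, U) q.asIdeal
  -- the fibre of `Spec Γ(X, V) → Spec Γ(Y, U)` over `p` is smooth
  have key : Smooth ((Spec.map (f.appLE U V hVU)).fiberToSpecResidueField p) := by
    have H := IsPullback.of_hasPullback f hU.fromSpec
    have h1 : Smooth ((pullback.snd f hU.fromSpec).fiberToSpecResidueField p) := by
      have H' := isPullback_fiberToSpecResidueField_of_isPullback H p
      have hy : hU.fromSpec p = f x := hU.fromSpec_primeIdealOf ⟨f x, hVU hxV⟩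
      have hs : Smooth (f.fiberToSpecResidueField (hU.fromSpec p)) := by rw [hy]; exact hsm
      exact MorphismProperty.of_isPullback H' hs
    let j : Spec Γ(X, V) ⟶ pullback f hU.fromSpec :=
      pullback.lift hV.fromSpec (Spec.map (f.appLE U V hVU))
        (IsAffineOpen.SpecMap_appLE_fromSpec f hU hV hVU).symm
    have hj : j ≫ pullback.snd f hU.fromSpec = Spec.map (f.appLE U V hVU) :=
      pullback.lift_snd _ _ _
    haveI : IsOpenImmersion j := by
      have : IsOpenImmersion (j ≫ pullback.fst f hU.fromSpec) := by
        rw [pullback.lift_fst]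
        infer_instance
      exact IsOpenImmersion.of_comp j (pullback.fst f hU.fromSpec)
    rw [← hj, Scheme.Hom.fiberToSpecResidueField, ← pullbackRightPullbackFstIso_inv_snd_snd]
    have h2 : Smooth (pullback.snd j (pullback.fst (pullback.snd f hU.fromSpec)
        ((Spec Γ(Y, U)).fromSpecResidueField p))) := inferInstance
    have h3 : Smooth (pullbackRightPullbackFstIso (pullback.snd f hU.fromSpec)
        ((Spec Γ(Y, U)).fromSpecResidueField p) j).inv := inferInstance
    exact MorphismProperty.comp_mem @Smooth _ _ h3 (MorphismProperty.comp_mem @Smooth _ _ h2 h1)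
  -- hence `κ(p) ⊗ Γ(X, V)` is formally smooth over `κ(p)`
  haveI : Algebra.FormallySmooth p.asIdeal.ResidueField (p.asIdeal.Fiber Γ(X, V)) := by
    rw [← RingHom.formallySmooth_algebraMap]
    refine RingHom.Smooth.formallySmooth ?_
    rw [← CommRingCat.hom_ofHom (algebraMap _ (p.asIdeal.Fiber Γ(X, V))),
      ← HasRingHomProperty.Spec_iff (P := @Smooth),
      ← MorphismProperty.arrow_mk_iso_iff (P := @Smooth)
        (Spec.fiberToSpecResidueFieldIso Γ(Y, U) Γ(X, V) p)]
    exact key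
  -- and `Γ(Y,U)_p → Γ(X,V)_q ≅ (𝒪_{Y,f x} → 𝒪_{X,x})` is flat
  refine Algebra.IsSmoothAt.of_flat_localRingHom_of_formallySmooth_fiber p.asIdeal q.asIdeal ?_
  exact (RingHom.Flat.respectsIso.arrow_mk_iso_iff
    (IsAffineOpen.arrowStalkMapIso f U hU V hV hVU hxV)).mp hflat

/-! ### Smoothness over an open neighbourhood of a fibre contained in the smooth locus -/

/-- **Spreading out from one fibre.** Let `f : X → Y` be locally of finite presentation and
universally closed (e.g. proper), and `y ∈ Y` such that every point of the fibre over `y` lies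
in the smooth locus of `f`. Then `f` is smooth over an open neighbourhood `V` of `y`, namely
`V = Y ∖ f(X ∖ sm(X/Y))` (open since `f` is closed). This is the elementary form of de Jong's
"`f` is smooth over a nonempty open part" in 4.12. [cite: DeJong1996, 4.12, p. 68] -/
theorem exists_smooth_morphismRestrict_of_forall_mem_smoothLocus (f : X ⟶ Y)
    [LocallyOfFinitePresentation f] [UniversallyClosed f] {y : Y}
    (h : ∀ x : X, f x = y → x ∈ f.smoothLocus) :
    ∃ V : Y.Opens, y ∈ V ∧ Smooth (f ∣_ V) := by
  have hcl : IsClosed (f '' (f.smoothLocus : Set X)ᶜ) :=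
    f.isClosedMap _ f.smoothLocus.isOpen.isClosed_compl
  refine ⟨⟨(f '' (f.smoothLocus : Set X)ᶜ)ᶜ, hcl.isOpen_compl⟩, ?_, ?_⟩
  · rintro ⟨x, hx, hxy⟩
    exact hx (h x hxy)
  · refine smooth_morphismRestrict_of_preimage_le_smoothLocus f _ fun x hx => ?_
    by_contra hxs
    exact hx ⟨x, hxs, rfl⟩

end Literature.AlgebraicGeometry.Morphisms

end
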